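import Summits.CriticalPhenomena.PercolationContinuityZ3.Theorems.PercNearOneGluingNoHeavyLowerTailSahiCTCLadderTripleT
import Summits.CriticalPhenomena.PercolationContinuityZ3.Theorems.PercNearOneGluingNoHeavyLowerTailSahiCTCKleitmanDegree
import HarnessLib

/-!
# `NoHeavyLowerTail` (crux stmt-CriticalPhenomena-4575), P3 lane: preparations for the row `#dbl = 4` of the level-3 ladder `(L_3)`

Support file (seat `prim-l12-p3`, gen 26; `--supports stmt-CriticalPhenomena-4575`).  Memo g26 §4.5.  For a profile `m ≤ 2` with doubled set
`D = dbl m` (`#D = 4`) and single set `T = lev m 1`: the Harris coefficients of the cubes of the row (`coeff_harris_cube_two/_one`: the 2-live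
links `upFam d` on `(D∖d) ∪ T` and the 1-live cubes with base a pair `p ⊆ D`), the LOOP bound for the 1-live cubes, and the counting on the
four-point set `D` used by the accounting of `…SahiCTCLadderThreeRowFour`: ordered/unordered pair sums, `a_p` (common triples through a pair) as
points of `D∖p`, the C₁-type sets versus pairs `(p,y)`, present points, and `#{covered pairs} = 3A − C(A,2)`; the data `codegA` (`a_p`), `cdegC`
(`c_p`), `kapTwo` (`κ₂(d)`), `kapOne` (`κ₁(p,y)`) and the TRIANGLE bound `tri_bound_cube_two`.  Nothing is asserted about the crux.
-/

namespace Summit.CriticalPhenomena.PercolationContinuityZ3.Theorems.SahiCTCForms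

open Finset MvPolynomial SahiCTCGenFun SahiCTCWeightedLYM

variable {α : Type*} [DecidableEq α] [Fintype α]

section RowFour
variable {𝒳 𝒵 : Finset (Finset α)}

omit [Fintype α] in
/-- For `m ≤ 2` the single set is the level set `1`. [this work] -/
theorem sgl_eq_lev_one {m : α →₀ ℕ} (hm : ∀ i, m i ≤ 2) : sgl m = lev m 1 := by
  ext i
  rw [sgl, mem_sdiff, dbl, mem_filter, Finsupp.mem_support_iff, lev, mem_filter, Finsupp.mem_support_iff]
  have := hm i
  constructor
  · rintro ⟨h1, h2⟩; exact ⟨h1, by by_contra h; exact h2 ⟨h1, by omega⟩⟩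
  · rintro ⟨h1, h2⟩; exact ⟨h1, fun h => by omega⟩

omit [DecidableEq α] [Fintype α] in
/-- `dbl m` and `lev m 1` are disjoint. [this work] -/
theorem disjoint_dbl_lev_one (m : α →₀ ℕ) : Disjoint (dbl m) (lev m 1) := by
  rw [dbl_eq_lev]; exact disjoint_filter.2 fun i _ h1 h2 => by omega

/-! #### The cubes of the row and their Harris coefficients -/

/-- The 2-live cube at `d ∈ D`: `[m − 1_{D∖d}] H = κ(upFam d 𝒳, upFam d 𝒵; ∅, (D∖d) ∪ T)`. [this work] -/
theorem coeff_harris_cube_two {m : α →₀ ℕ} (hm : ∀ i, m i ≤ 2) {d : α} (hd : d ∈ dbl m) :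
    (PiP * gf (𝒳 ∩ 𝒵) - gf 𝒳 * gf 𝒵).coeff (m - ind ((dbl m).erase d)) =
      kap (upFam d 𝒳) (upFam d 𝒵) ∅ ((dbl m).erase d ∪ lev m 1) := by
  rw [coeff_harrisForm_eq_kap _ _ (sub_ind_le_two_of_le_two hm _), dbl_sub_ind_of_le_two hm, sgl_sub_ind_of_le_two hm, kap_upFam,
    insert_empty]
  congr 1
  · rw [sdiff_erase hd, sdiff_self]; rfl
  · rw [inter_eq_right.2 (erase_subset d _)]
    congr 1
    exact sdiff_eq_self_of_disjoint ((disjoint_dbl_lev_one m).symm.mono_right (erase_subset d _))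

/-- The 1-live cube at `(p, y)`, `p ⊆ D` a pair, `y ∈ T`: `[m − 1_{(D∖p)+y}] H = κ(𝒳,𝒵; p, (D∖p) ∪ (T∖y))`. [this work] -/
theorem coeff_harris_cube_one {m : α →₀ ℕ} (hm : ∀ i, m i ≤ 2) {p : Finset α} (hp : p ⊆ dbl m) {y : α} (hy : y ∈ lev m 1) :
    (PiP * gf (𝒳 ∩ 𝒵) - gf 𝒳 * gf 𝒵).coeff (m - ind (insert y (dbl m \ p))) =
      kap 𝒳 𝒵 p ((dbl m \ p) ∪ (lev m 1).erase y) := by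
  rw [coeff_harrisForm_eq_kap _ _ (sub_ind_le_two_of_le_two hm _), dbl_sub_ind_of_le_two hm, sgl_sub_ind_of_le_two hm]
  have hyD : y ∉ dbl m := fun h => disjoint_left.1 (disjoint_dbl_lev_one m) h hy
  congr 1
  · -- dbl m \ insert y (dbl m \ p) = p
    ext i; simp only [mem_sdiff, mem_insert, not_or]
    constructor
    · rintro ⟨hi, hne, h⟩; by_contra hip; exact h ⟨hi, hip⟩
    · intro hip; exact ⟨hp hip, fun h => hyD (h ▸ hp hip), fun h => h.2 hip⟩
  · congr 1
    · ext i; simp only [mem_inter, mem_insert, mem_sdiff]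
      constructor
      · rintro ⟨hi, rfl | ⟨hi', hip⟩⟩
        · exact absurd hi hyD
        · exact ⟨hi', hip⟩
      · rintro ⟨hi, hip⟩; exact ⟨hi, Or.inr ⟨hi, hip⟩⟩
    · ext i; simp only [mem_sdiff, mem_insert, mem_erase, not_or]
      constructor
      · rintro ⟨hi, hne, _⟩; exact ⟨hne, hi⟩
      · rintro ⟨hne, hi⟩; exact ⟨hi, hne, fun h => disjoint_left.1 (disjoint_dbl_lev_one m) h.1 hi⟩

/-! #### Local bounds -/

omit [Fintype α] in
/-- 1-live cube with an A-loop: if `p ∪ u ∈ 𝒳 ∩ 𝒵` for some `u ∈ D∖p` then `κ(p, (D∖p) ∪ (T∖y)) ≥ 1`. [this work] -/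
theorem one_le_kap_cube_one_of_A (h𝒳 : IsUpperSet (𝒳 : Set (Finset α))) (h𝒵 : IsUpperSet (𝒵 : Set (Finset α)))
    (hX3 : ∀ S ∈ 𝒳, 3 ≤ #S) (hZ3 : ∀ S ∈ 𝒵, 3 ≤ #S) {m : α →₀ ℕ} {p : Finset α} (hp2 : #p = 2) {u : α} (hu : u ∈ dbl m \ p)
    (huX : insert u p ∈ 𝒳) (huZ : insert u p ∈ 𝒵) (y : α) : 1 ≤ kap 𝒳 𝒵 p ((dbl m \ p) ∪ (lev m 1).erase y) :=
  one_le_kap_of_loop h𝒳 h𝒵 (fun h => by have := hX3 _ h; omega) (fun h => by have := hZ3 _ h; omega)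
    (mem_union_left _ hu) huX huZ

/-! #### Counting on the four-point set `D` -/

omit [Fintype α] in
/-- Ordered versus unordered pairs: `Σ_{(d,x) ∈ D.offDiag} g {d,x} = 2·Σ_{p ⊆ D, #p = 2} g p`. [folklore] -/
theorem sum_offDiag_pair_eq (D : Finset α) (g : Finset α → ℤ) :
    ∑ q ∈ D.offDiag, g {q.1, q.2} = 2 * ∑ p ∈ D.powersetCard 2, g p := by
  have hmaps : ∀ q ∈ D.offDiag, ({q.1, q.2} : Finset α) ∈ D.powersetCard 2 := fun q hq => by
    obtain ⟨h1, h2, h12⟩ := mem_offDiag.1 hq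
    exact mem_powersetCard.2 ⟨insert_subset h1 (singleton_subset_iff.2 h2), card_pair h12⟩
  rw [← sum_fiberwise_of_maps_to hmaps, mul_sum]
  refine sum_congr rfl fun p hp => ?_
  obtain ⟨hpD, hp2⟩ := mem_powersetCard.1 hp
  obtain ⟨a, b, hab, rfl⟩ := card_eq_two.1 hp2
  have hfib : (D.offDiag.filter fun q => ({q.1, q.2} : Finset α) = {a, b}) = {(a, b), (b, a)} := by
    ext q
    simp only [mem_filter, mem_offDiag, mem_insert, mem_singleton]
    constructor
    · rintro ⟨⟨_, _, hne⟩, heq⟩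
      have h1 : q.1 ∈ ({a, b} : Finset α) := by rw [← heq]; exact mem_insert_self _ _
      have h2 : q.2 ∈ ({a, b} : Finset α) := by rw [← heq]; exact mem_insert_of_mem (mem_singleton_self _)
      simp only [mem_insert, mem_singleton] at h1 h2
      rcases h1 with h1 | h1 <;> rcases h2 with h2 | h2
      · exact absurd (h1.trans h2.symm) hne
      · left; exact Prod.ext h1 h2
      · right; exact Prod.ext h1 h2
      · exact absurd (h1.trans h2.symm) hne
    · rintro (rfl | rfl)
      · exact ⟨⟨hpD (mem_insert_self a _), hpD (mem_insert_of_mem (mem_singleton_self b)), hab⟩, rfl⟩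
      · exact ⟨⟨hpD (mem_insert_of_mem (mem_singleton_self b)), hpD (mem_insert_self a _), hab.symm⟩, pair_comm b a⟩
  rw [sum_congr rfl fun q hq => by rw [(mem_filter.1 hq).2], sum_const, hfib, card_pair (fun h => hab (Prod.ext_iff.1 h).1)]
  simp [two_mul]

omit [Fintype α] in
/-- The common 3-subsets of `D` containing a pair `p ⊆ D` ↔ the points `u ∈ D∖p` with `p + u` common. [this work] -/
theorem card_filter_insert_eq {D p : Finset α} (hpD : p ⊆ D) (hp2 : #p = 2) :
    #((D \ p).filter fun u => insert u p ∈ 𝒳 ∧ insert u p ∈ 𝒵) =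
      #((((𝒳 ∩ 𝒵).filter fun S => #S = 3).filter fun w => w ⊆ D).filter fun w => p ⊆ w) := by
  refine card_bij (fun u _ => insert u p) (fun u hu => ?_) (fun u hu u' hu' h => ?_) (fun w hw => ?_)
  · obtain ⟨huD, hX, hZ⟩ := mem_filter.1 hu
    obtain ⟨huD', hup⟩ := mem_sdiff.1 huD
    refine mem_filter.2 ⟨mem_filter.2 ⟨mem_filter.2 ⟨mem_inter.2 ⟨hX, hZ⟩, by rw [card_insert_of_notMem hup, hp2]⟩,
      insert_subset huD' hpD⟩, subset_insert u p⟩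
  · have hup : u ∉ p := (mem_sdiff.1 (mem_filter.1 hu).1).2
    have : u ∈ insert u' p := by rw [← h]; exact mem_insert_self u p
    rcases mem_insert.1 this with h' | h'
    · exact h'
    · exact absurd h' hup
  · obtain ⟨hw', hpw⟩ := mem_filter.1 hw
    obtain ⟨hw'', hwD⟩ := mem_filter.1 hw'
    obtain ⟨hwXZ, hw3⟩ := mem_filter.1 hw''
    have hc : #(w \ p) = 1 := by rw [card_sdiff_of_subset hpw, hw3, hp2]
    obtain ⟨u, hu⟩ := card_eq_one.1 hc
    have huw : u ∈ w \ p := by rw [hu]; exact mem_singleton_self u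
    refine ⟨u, mem_filter.2 ⟨mem_sdiff.2 ⟨hwD (mem_sdiff.1 huw).1, (mem_sdiff.1 huw).2⟩, ?_⟩, ?_⟩
    · have : insert u p = w := by rw [← union_sdiff_of_subset hpw, hu, union_comm]; rfl
      rw [this]; exact mem_inter.1 hwXZ
    · rw [← union_sdiff_of_subset hpw, hu, union_comm]; rfl

omit [Fintype α] in
/-- `Σ_{d ∈ D} Σ_{x ∈ D∖d} f d x = Σ_{q ∈ D.offDiag} f q.1 q.2`. [folklore] -/
theorem sum_erase_eq_sum_offDiag {β : Type*} [AddCommMonoid β] (D : Finset α) (f : α → α → β) :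
    ∑ d ∈ D, ∑ x ∈ D.erase d, f d x = ∑ q ∈ D.offDiag, f q.1 q.2 := by
  rw [sum_sigma']
  refine sum_bij' (fun q _ => (q.1, q.2)) (fun q _ => ⟨q.1, q.2⟩) (fun q hq => ?_) (fun q hq => ?_) (fun _ _ => rfl) (fun _ _ => rfl)
    (fun _ _ => rfl)
  · obtain ⟨h1, h2⟩ := mem_sigma.1 hq
    exact mem_offDiag.2 ⟨h1, (mem_erase.1 h2).2, fun h => (mem_erase.1 h2).1 h.symm⟩
  · obtain ⟨h1, h2, h12⟩ := mem_offDiag.1 hq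
    exact mem_sigma.2 ⟨h1, mem_erase.2 ⟨fun h => h12 h.symm, h2⟩⟩

omit [Fintype α] in
/-- For `m ≤ 2` the support is `dbl m ∪ lev m 1`. [this work] -/
theorem support_eq_dbl_union_lev {m : α →₀ ℕ} (hm : ∀ i, m i ≤ 2) : m.support = dbl m ∪ lev m 1 := by
  ext i
  rw [mem_union, dbl, mem_filter, lev, mem_filter, Finsupp.mem_support_iff]
  have := hm i
  constructor
  · intro h; by_cases h2 : m i = 2
    · exact Or.inl ⟨h, h2⟩
    · exact Or.inr ⟨h, by omega⟩
  · rintro (⟨h, _⟩ | ⟨h, _⟩) <;> exact h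

omit [Fintype α] in
/-- The C₁-type common sets are covered by the pairs `(p, y)`, `p ⊆ D` a pair, `y ∈ T`, `p + y ∈ W`:
`#{w ∈ W : w ⊆ supp m, #(D∩w) = 2} ≤ Σ_p #{y ∈ T : p + y ∈ W}`. [this work] -/
theorem card_WC_le_sum {m : α →₀ ℕ} (hm : ∀ i, m i ≤ 2) (W : Finset (Finset α)) (hW : ∀ w ∈ W, #w = 3) :
    #((W.filter fun w => ind w ≤ m).filter fun w => #(dbl m ∩ w) = 2) ≤
      ∑ p ∈ (dbl m).powersetCard 2, #((lev m 1).filter fun y => insert y p ∈ W) := by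
  set WC := (W.filter fun w => ind w ≤ m).filter fun w => #(dbl m ∩ w) = 2
  set Dom := ((dbl m).powersetCard 2 ×ˢ lev m 1).filter fun q => insert q.2 q.1 ∈ W
  have h1 : #WC ≤ #Dom := by
    refine card_le_card_of_surjOn (fun q => insert q.2 q.1) fun w hw => ?_
    obtain ⟨hw', hDw⟩ := mem_filter.1 (Finset.mem_coe.1 hw)
    obtain ⟨hwW, hwm⟩ := mem_filter.1 hw'
    have hwsupp : w ⊆ dbl m ∪ lev m 1 := support_eq_dbl_union_lev hm ▸ (SahiAllButC.ind_le_iff_subset_support _ _).1 hwm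
    have hc : #(w \ dbl m) = 1 := by
      have := card_sdiff_add_card_inter w (dbl m); rw [inter_comm, hDw, hW w hwW] at this; omega
    obtain ⟨y, hy⟩ := card_eq_one.1 hc
    have hyw : y ∈ w \ dbl m := by rw [hy]; exact mem_singleton_self y
    obtain ⟨hyw', hyD⟩ := mem_sdiff.1 hyw
    have hyT : y ∈ lev m 1 := (mem_union.1 (hwsupp hyw')).resolve_left hyD
    have heq : insert y (dbl m ∩ w) = w := by
      ext i; simp only [mem_insert, mem_inter]
      constructor
      · rintro (rfl | ⟨_, hi⟩)
        · exact hyw'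
        · exact hi
      · intro hi
        by_cases hiD : i ∈ dbl m
        · exact Or.inr ⟨hiD, hi⟩
        · have : i ∈ w \ dbl m := mem_sdiff.2 ⟨hi, hiD⟩
          rw [hy, mem_singleton] at this; exact Or.inl this
    refine ⟨(dbl m ∩ w, y), Finset.mem_coe.2 (mem_filter.2 ⟨mem_product.2 ⟨mem_powersetCard.2 ⟨inter_subset_left, hDw⟩, hyT⟩, ?_⟩), heq⟩
    show insert y (dbl m ∩ w) ∈ W
    rw [heq]; exact hwW
  refine h1.trans (le_of_eq ?_)
  rw [card_filter, sum_product]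
  refine sum_congr rfl fun p _ => ?_
  rw [card_filter]

omit [Fintype α] in
/-- The points `u ∈ D` whose co-point triple `D∖u` is common; their number is `A = #W[D]`. [this work] -/
theorem card_pres_eq {D : Finset α} (hD : #D = 4) (W : Finset (Finset α)) (hW : ∀ w ∈ W, #w = 3) :
    #(D.filter fun u => D.erase u ∈ W) = #(W.filter fun w => w ⊆ D) := by
  refine card_bij (fun u _ => D.erase u) (fun u hu => ?_) (fun u hu u' hu' h => ?_) (fun w hw => ?_)
  · exact mem_filter.2 ⟨(mem_filter.1 hu).2, erase_subset u D⟩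
  · exact erase_injOn D (mem_filter.1 hu).1 (mem_filter.1 hu').1 h
  · obtain ⟨hwW, hwD⟩ := mem_filter.1 hw
    have hc : #(D \ w) = 1 := by rw [card_sdiff_of_subset hwD, hD, hW w hwW]
    obtain ⟨u, hu⟩ := card_eq_one.1 hc
    have huD : u ∈ D \ w := by rw [hu]; exact mem_singleton_self u
    have heq : D.erase u = w := by
      rw [← sdiff_singleton_eq_erase, ← hu, Finset.sdiff_sdiff_eq_self hwD]
    exact ⟨u, mem_filter.2 ⟨(mem_sdiff.1 huD).1, heq ▸ hwW⟩, heq⟩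

omit [Fintype α] in
/-- For a pair `p ⊆ D` and `u ∈ D∖p`, `p + u = D ∖ u'` where `u'` is the other point of `D∖p` (`#D = 4`). [this work] -/
theorem insert_eq_erase_of_pair {D p : Finset α} (hD : #D = 4) (hpD : p ⊆ D) (hp2 : #p = 2) {u u' : α}
    (hu : u ∈ D \ p) (hu' : u' ∈ D \ p) (huu' : u ≠ u') : insert u p = D.erase u' := by
  have hc : #(D \ p) = 2 := by rw [card_sdiff_of_subset hpD, hD, hp2]
  have hDp : D \ p = {u, u'} := by
    refine (eq_of_subset_of_card_le (insert_subset hu (singleton_subset_iff.2 hu')) ?_).symm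
    rw [hc, card_pair huu']
  ext i
  simp only [mem_insert, mem_erase]
  constructor
  · rintro (rfl | hip)
    · exact ⟨huu', (mem_sdiff.1 hu).1⟩
    · exact ⟨fun h => (mem_sdiff.1 hu').2 (h ▸ hip), hpD hip⟩
  · rintro ⟨hne, hiD⟩
    by_cases hip : i ∈ p
    · exact Or.inr hip
    · have : i ∈ D \ p := mem_sdiff.2 ⟨hiD, hip⟩
      rw [hDp, mem_insert, mem_singleton] at this
      rcases this with h | h
      · exact Or.inl h
      · exact absurd h hne

omit [Fintype α] in
/-- A pair `p ⊆ D` has co-degree `2` (both triples through it common) iff `D∖p` consists of 'present' points. [this work] -/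
theorem codeg_eq_two_iff {D p : Finset α} (hD : #D = 4) (hpD : p ⊆ D) (hp2 : #p = 2) (W : Finset (Finset α)) :
    #((D \ p).filter fun u => insert u p ∈ W) = 2 ↔ D \ p ⊆ D.filter fun u => D.erase u ∈ W := by
  have hc : #(D \ p) = 2 := by rw [card_sdiff_of_subset hpD, hD, hp2]
  obtain ⟨u, u', huu', hDp⟩ := card_eq_two.1 hc
  have hu : u ∈ D \ p := by rw [hDp]; exact mem_insert_self _ _
  have hu' : u' ∈ D \ p := by rw [hDp]; exact mem_insert_of_mem (mem_singleton_self _)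
  have e1 : insert u p = D.erase u' := insert_eq_erase_of_pair hD hpD hp2 hu hu' huu'
  have e2 : insert u' p = D.erase u := insert_eq_erase_of_pair hD hpD hp2 hu' hu huu'.symm
  constructor
  · intro h
    have hall : (D \ p).filter (fun u => insert u p ∈ W) = D \ p := eq_of_subset_of_card_le (filter_subset _ _) (by rw [h, hc])
    intro x hx
    have hx' := hx
    rw [← hall, mem_filter] at hx'
    rw [hDp, mem_insert, mem_singleton] at hx
    refine mem_filter.2 ⟨(mem_sdiff.1 hx'.1).1, ?_⟩
    rcases hx with rfl | rfl
    · have := (hall.symm ▸ hu' : u' ∈ (D \ p).filter fun u => insert u p ∈ W)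
      rw [mem_filter, e2] at this; exact this.2
    · have := (hall.symm ▸ hu : u ∈ (D \ p).filter fun u => insert u p ∈ W)
      rw [mem_filter, e1] at this; exact this.2
  · intro h
    have : (D \ p).filter (fun u => insert u p ∈ W) = D \ p := by
      refine filter_true_of_mem fun x hx => ?_
      have hx' := hx
      rw [hDp, mem_insert, mem_singleton] at hx'
      rcases hx' with rfl | rfl
      · rw [e1]; exact (mem_filter.1 (h hu')).2
      · rw [e2]; exact (mem_filter.1 (h hu)).2
    rw [this, hc]

omit [Fintype α] in
/-- **Covered pairs**: with `a_p = #{u ∈ D∖p : p + u ∈ W}` (`≤ 2`) on the six pairs of `D` (`#D = 4`) and `A = #W[D]`: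
`Σ_p a_p = 3A` and `#{p : a_p = 2} = C(A,2)`, hence `#{p : a_p ≥ 1} = 3A − C(A,2)`. [this work] -/
theorem card_covered_pairs {D : Finset α} (hD : #D = 4) (W : Finset (Finset α)) (hW : ∀ w ∈ W, #w = 3) :
    (#((D.powersetCard 2).filter fun p => 1 ≤ #((D \ p).filter fun u => insert u p ∈ W)) : ℤ) =
      3 * #(W.filter fun w => w ⊆ D) - (#(W.filter fun w => w ⊆ D)).choose 2 := by
  set Pairs := D.powersetCard 2
  set a : Finset α → ℕ := fun p => #((D \ p).filter fun u => insert u p ∈ W)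
  set WD := W.filter fun w => w ⊆ D
  have ha2 : ∀ p ∈ Pairs, a p ≤ 2 := fun p hp => by
    obtain ⟨hpD, hp2⟩ := mem_powersetCard.1 hp
    calc a p ≤ #(D \ p) := card_filter_le _ _
      _ = 2 := by rw [card_sdiff_of_subset hpD, hD, hp2]
  -- Σ a = 3·#WD
  have hsum : ∑ p ∈ Pairs, a p = 3 * #WD := by
    have hWD : ∀ w ∈ WD, w ⊆ D ∧ #w = 3 := fun w hw => ⟨(mem_filter.1 hw).2, hW w (mem_filter.1 hw).1⟩
    have e : ∀ p ∈ Pairs, a p = #(WD.filter fun w => p ⊆ w) := fun p hp => by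
      obtain ⟨hpD, hp2⟩ := mem_powersetCard.1 hp
      have := card_filter_insert_eq (𝒳 := W) (𝒵 := W) hpD hp2
      simp only [and_self, inter_self] at this
      rw [show ((W.filter fun S => #S = 3).filter fun w => w ⊆ D) = WD from by
        ext w; simp only [WD, mem_filter]; exact ⟨fun h => ⟨h.1.1, h.2⟩, fun h => ⟨⟨h.1, hW w h.1⟩, h.2⟩⟩] at this
      exact this
    rw [sum_congr rfl e]
    have h := sum_card_bipartiteAbove_eq_sum_card_bipartiteBelow (s := Pairs) (t := WD) (r := fun p w => p ⊆ w)
    simp only [bipartiteAbove, bipartiteBelow] at h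
    rw [h]
    have : ∀ w ∈ WD, #(Pairs.filter fun p => p ⊆ w) = 3 := fun w hw => by
      obtain ⟨hwD, hw3⟩ := hWD w hw
      have : (Pairs.filter fun p => p ⊆ w) = w.powersetCard 2 := by
        ext p; simp only [Pairs, mem_filter, mem_powersetCard]
        exact ⟨fun h => ⟨h.2, h.1.2⟩, fun h => ⟨⟨h.1.trans hwD, h.2⟩, h.1⟩⟩
      rw [this, card_powersetCard, hw3]; rfl
    rw [sum_congr rfl this, sum_const, smul_eq_mul, mul_comm]
  -- #{a = 2} = C(A,2)
  set Pres := D.filter fun u => D.erase u ∈ W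
  have hPres : #Pres = #WD := card_pres_eq hD W hW
  have hQ : #(Pairs.filter fun p => a p = 2) = (#WD).choose 2 := by
    rw [← hPres, ← card_powersetCard]
    refine card_bij (fun p _ => D \ p) (fun p hp => ?_) (fun p hp p' hp' h => ?_) (fun q hq => ?_)
    · obtain ⟨hp, hap⟩ := mem_filter.1 hp
      obtain ⟨hpD, hp2⟩ := mem_powersetCard.1 hp
      exact mem_powersetCard.2 ⟨(codeg_eq_two_iff hD hpD hp2 W).1 hap, by rw [card_sdiff_of_subset hpD, hD, hp2]⟩
    · have h1 := (mem_powersetCard.1 (mem_filter.1 hp).1).1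
      have h2 := (mem_powersetCard.1 (mem_filter.1 hp').1).1
      rw [← Finset.sdiff_sdiff_eq_self h1, h, Finset.sdiff_sdiff_eq_self h2]
    · obtain ⟨hqP, hq2⟩ := mem_powersetCard.1 hq
      have hqD : q ⊆ D := hqP.trans (filter_subset _ _)
      have hp2 : #(D \ q) = 2 := by rw [card_sdiff_of_subset hqD, hD, hq2]
      refine ⟨D \ q, mem_filter.2 ⟨mem_powersetCard.2 ⟨sdiff_subset, hp2⟩, ?_⟩, Finset.sdiff_sdiff_eq_self hqD⟩
      exact (codeg_eq_two_iff hD sdiff_subset hp2 W).2 (by rw [Finset.sdiff_sdiff_eq_self hqD]; exact hqP)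
  -- P + Q = Σ a
  have hPQ : #(Pairs.filter fun p => 1 ≤ a p) + #(Pairs.filter fun p => a p = 2) = ∑ p ∈ Pairs, a p := by
    rw [card_filter, card_filter, ← sum_add_distrib]
    refine sum_congr rfl fun p hp => ?_
    have := ha2 p hp
    rcases Nat.lt_or_ge (a p) 1 with h | h
    · rw [if_neg (by omega), if_neg (by omega)]; omega
    · rw [if_pos h]; by_cases h2 : a p = 2
      · rw [if_pos h2]; omega
      · rw [if_neg h2]; omega
  rw [hsum, hQ] at hPQ
  have h1 : (#(Pairs.filter fun p => 1 ≤ a p) : ℤ) + ((#WD).choose 2 : ℕ) = ((3 * #WD : ℕ) : ℤ) := by exact_mod_cast hPQ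
  push_cast at h1
  linarith

/-! #### The data of the accounting -/

/-- `a_p`: the points `u ∈ D∖p` with `p + u ∈ 𝒳 ∩ 𝒵` (co-degree of the pair `p` among the common 3-subsets of `D = dbl m`). [this work] -/
def codegA (𝒳 𝒵 : Finset (Finset α)) (m : α →₀ ℕ) (p : Finset α) : ℕ :=
  #((dbl m \ p).filter fun u => insert u p ∈ 𝒳 ∧ insert u p ∈ 𝒵)

/-- `c_p`: the points `y ∈ T = lev m 1` with `p + y` a common 3-set. [this work] -/
def cdegC (𝒳 𝒵 : Finset (Finset α)) (m : α →₀ ℕ) (p : Finset α) : ℕ :=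
  #((lev m 1).filter fun y => insert y p ∈ (𝒳 ∩ 𝒵).filter fun S => #S = 3)

/-- `κ₂(d)`: the surplus of the 2-live cube at `d` (links at `d` on `(D∖d) ∪ T`). [this work] -/
def kapTwo (𝒳 𝒵 : Finset (Finset α)) (m : α →₀ ℕ) (d : α) : ℤ := kap (upFam d 𝒳) (upFam d 𝒵) ∅ ((dbl m).erase d ∪ lev m 1)

/-- `κ₁(p,y)`: the surplus of the 1-live cube with base `p` on `(D∖p) ∪ (T∖y)`. [this work] -/
def kapOne (𝒳 𝒵 : Finset (Finset α)) (m : α →₀ ℕ) (p : Finset α) (y : α) : ℤ := kap 𝒳 𝒵 p ((dbl m \ p) ∪ (lev m 1).erase y)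

omit [Fintype α] in
/-- `{u, d, x} = {d, x, u}` as finsets. [this work] -/
theorem insert_pair_comm (u d x : α) : insert u ({d, x} : Finset α) = insert d {x, u} := by
  ext i; simp only [mem_insert, mem_singleton]; tauto

/-- **TRIANGLE on the 2-live cube at `d`** when every 3-subset of `D` is common: `κ₂(d) ≥ τ + 4`. [this work] -/
theorem tri_bound_cube_two (h𝒳 : IsUpperSet (𝒳 : Set (Finset α))) (h𝒵 : IsUpperSet (𝒵 : Set (Finset α)))
    (hX3 : ∀ S ∈ 𝒳, 3 ≤ #S) (hZ3 : ∀ S ∈ 𝒵, 3 ≤ #S) {m : α →₀ ℕ} (hD : #(dbl m) = 4) {d : α} (hd : d ∈ dbl m)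
    (hall : ∀ w ∈ (dbl m).powersetCard 3, w ∈ 𝒳 ∧ w ∈ 𝒵) :
    (#(lev m 1) : ℤ) + 4 ≤ kapTwo 𝒳 𝒵 m d := by
  unfold kapTwo
  have h3 : #((dbl m).erase d) = 3 := by have := card_erase_add_one hd; omega
  obtain ⟨x, y, z, hxy, hxz, hyz, hDe⟩ := card_eq_three.1 h3
  have hmem : ∀ u, u ∈ (dbl m).erase d ↔ u = x ∨ u = y ∨ u = z := fun u => by rw [hDe]; simp
  have hx := (hmem x).2 (Or.inl rfl); have hy := (hmem y).2 (Or.inr (Or.inl rfl)); have hz := (hmem z).2 (Or.inr (Or.inr rfl))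
  have htri : ∀ u v, u ∈ (dbl m).erase d → v ∈ (dbl m).erase d → u ≠ v →
      ({u, v} : Finset α) ∈ upFam d 𝒳 ∩ upFam d 𝒵 := fun u v hu hv huv => by
    rw [mem_inter, mem_upFam, mem_upFam]
    refine hall _ (mem_powersetCard.2 ⟨?_, ?_⟩)
    · exact insert_subset hd (insert_subset (mem_of_mem_erase hu) (singleton_subset_iff.2 (mem_of_mem_erase hv)))
    · rw [card_insert_of_notMem, card_pair huv]
      simp only [mem_insert, mem_singleton, not_or]
      exact ⟨(ne_of_mem_erase hu).symm, (ne_of_mem_erase hv).symm⟩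
  have h := card_add_one_le_kap_of_triangle (isUpperSet_upFam h𝒳) (isUpperSet_upFam h𝒵)
    (fun U hU => by have := upFam_live (b := d) hX3 U hU; omega) (fun U hU => by have := upFam_live (b := d) hZ3 U hU; omega)
    (mem_union_left (lev m 1) hx) (mem_union_left (lev m 1) hy) (mem_union_left (lev m 1) hz) (htri x y hx hy hxy)
    (htri y z hy hz hyz) (htri x z hx hz hxz)
    hxy hyz hxz
  rw [card_union_of_disjoint ((disjoint_dbl_lev_one m).mono_left (erase_subset _ _)), h3] at h
  push_cast at h; linarith


end RowFour

end Summit.CriticalPhenomena.PercolationContinuityZ3.Theorems.SahiCTCForms
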